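import Summits.PneNP.PneNP.Theorems.SzkEntropyPeaThreeNotInPTensorIsoDefs
import Literature.Computability.Complexity.CodeFPListKit
import Literature.Computability.Complexity.PEADegreeReduction

/-!
# Route SzkEntropy, crux `PeaThreeNotInP` (stmt-PneNP-10776), line `SketchIdeator3`, stub
# `stub_instanceFP`: the guarded instance map `pedOfG : TIInst → PEDInst` is typed polynomial time

The Karp step `TensorIso ≤ₚ PED 4` of the line (`SzkEntropyPeaThreeNotInPTensorIsoDefs.lean`).
We write `pedOfG` on the UNTYPED presentation of both sides (formats, index triples and variable
indices as naturals; the codes are tuples and nested lists of binary numerals) as list functions —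
`monoN` (the values of `varA/varB/varC`), `orbitN`, `mixN`, `shiftN`/`powN` (re-indexing, iterated
direct products), `suppN`/`suppXN` (supports of a support tensor / of a sum of two), `pedN`, and the
guarded `progN` (`pedN` when `a, b, c ≤ |L_S|` — the list `L_S` is the unary budget of the loops
over `i < a`, `j < b`, `k < c` — else the untyped fixed NO instance), prove them polynomial
time on codes in the typed algebra `CodeFP` (`map`, `filter`, `mem`, `rawProduct`, `brange`),
identify the Boolean codes of `TIInst`/`PEDInst` with the `CodeFP` codes of the presentations,
and prove `rawPED (pedOfG I) = progN (rawTI I)` layer by layer.  Refs: S. Arora, B. Barak,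
*Computational Complexity*, 2009, §0.1, §1.3, §2.1; Z. Dvir, D. Gutfreund, G. N. Rothblum,
S. Vadhan, *On approximating the entropy of polynomial mappings*, ICS 2011, §3 (products `pᵗ`).
-/

noncomputable section
open Finset Matrix
open scoped Kronecker
open _root_.Computability Literature.InformationTheory.Entropy Literature.Computability.Complexity
namespace Summit.PneNP.PneNP.Cruxes.PeaThreeNotInP.TensorIsoLine
set_option linter.dupNamespace false -- `Summit.PneNP.PneNP.…`: summit = sub-problem name (D-0017 single-conjunct layout)

open CodeFP

/-- The monomial `A i i' · B j j' · C k k'` of output `o = (i, j, k)` and support point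
`p = (i', j', k')` as variable indices (values of `varA/varB/varC` for formats `q`). [folklore] -/
def monoN (q o p : ℕ × ℕ × ℕ) : List ℕ :=
  [p.1 + q.1 * o.1, q.1 * q.1 + (p.2.1 + q.2.1 * o.2.1),
    (q.1 * q.1 + q.2.1 * q.2.1) + (p.2.2 + q.2.2 * o.2.2)]

/-- The untyped orbit map: per output position `o ∈ oi` one cubic monomial per support point.
[card tensor-orbit-two-query] -/
def orbitN (q : ℕ × ℕ × ℕ) (oi supp : List (ℕ × ℕ × ℕ)) : List (List (List ℕ)) :=
  oi.map fun o => supp.map (monoN q o)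

/-- The untyped mixture map: per output position the monomials of the second tensor, then those of
the sum tensor with the selector variable `nvars a b c` in front. [card tensor-iso-monoid-import] -/
def mixN (q : ℕ × ℕ × ℕ) (oi sT sX : List (ℕ × ℕ × ℕ)) : List (List (List ℕ)) :=
  oi.map fun o => sT.map (monoN q o) ++ (sX.map (monoN q o)).map (List.cons (nvars q.1 q.2.1 q.2.2))

/-- Re-indexing all variables of an untyped sparse map by `s + ·`. [folklore] -/
def shiftN (s : ℕ) (P : List (List (List ℕ))) : List (List (List ℕ)) :=
  P.map (List.map (List.map fun i => s + i))

/-- Iterated direct product, untyped: the copies `shiftN (n s) P`, `s ∈ ts`, concatenated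
(`ts = [0, …, t-1]` gives `powMap P t`). [DvirGutfreundRothblumVadhan2010, §3 p.6] -/
def powN (n : ℕ) (P : List (List (List ℕ))) (ts : List ℕ) : List (List (List ℕ)) :=
  (ts.map fun s => shiftN (n * s) P).flatten

/-- The support list of the support tensor of `L`: the positions `oi` lying in `L`. [folklore] -/
def suppN (L oi : List (ℕ × ℕ × ℕ)) : List (ℕ × ℕ × ℕ) := oi.filter fun p => decide (p ∈ L)

/-- The support list of the SUM of two support tensors: the positions in exactly one list
(`1 + 1 = 0` in `F₂`). [folklore] -/
def suppXN (LS LT oi : List (ℕ × ℕ × ℕ)) : List (ℕ × ℕ × ℕ) :=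
  oi.filter fun p => (decide (p ∈ LS) != decide (p ∈ LT))

/-- **The untyped `PED 4` instance** for formats `q`, positions `oi`, supports `LS`, `LT`: `128`
copies of the mixture map on `nvars + 1` variables against `64 + 64` copies of the two orbit maps
and one fresh variable (the untyped `(pedP, pedQ)`). [card tensor-iso-monoid-import] -/
def pedN (q : ℕ × ℕ × ℕ) (oi LS LT : List (ℕ × ℕ × ℕ)) :
    (ℕ × List (List (List ℕ))) × (ℕ × List (List (List ℕ))) :=
  (((nvars q.1 q.2.1 q.2.2 + 1) * 128,
    powN (nvars q.1 q.2.1 q.2.2 + 1) (mixN q oi (suppN LT oi) (suppXN LS LT oi)) (List.range 128)),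
   (nvars q.1 q.2.1 q.2.2 * 64 + (nvars q.1 q.2.1 q.2.2 * 64 + 1),
    powN (nvars q.1 q.2.1 q.2.2) (orbitN q oi (suppN LS oi)) (List.range 64) ++
      shiftN (nvars q.1 q.2.1 q.2.2 * 64)
        (powN (nvars q.1 q.2.1 q.2.2) (orbitN q oi (suppN LT oi)) (List.range 64) ++
          shiftN (nvars q.1 q.2.1 q.2.2 * 64) [[[0]]])))

/-- **The untyped guarded instance map** on `x = (a, b, c, LS, LT)`: under the guard
`a, b, c ≤ |LS|`, `pedN` over the positions `[0,a) × [0,b) × [0,c)` (ranges capped by the unary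
budget `|LS|`), else the untyped `PEAToPED.noInst`. [card tensor-iso-monoid-import] -/
def progN (x : ℕ × ℕ × ℕ × List (ℕ × ℕ × ℕ) × List (ℕ × ℕ × ℕ)) :
    (ℕ × List (List (List ℕ))) × (ℕ × List (List (List ℕ))) :=
  if decide (x.1 ≤ x.2.2.2.1.length) &&
      (decide (x.2.1 ≤ x.2.2.2.1.length) && decide (x.2.2.1 ≤ x.2.2.2.1.length)) then
    pedN (x.1, x.2.1, x.2.2.1) (List.range (min x.1 x.2.2.2.1.length) ×ˢ
      (List.range (min x.2.1 x.2.2.2.1.length) ×ˢ List.range (min x.2.2.1 x.2.2.2.1.length)))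
      x.2.2.2.1 x.2.2.2.2
  else ((0, []), (1, [[[0]]]))

/-- Code of a triple of naturals: three binary numerals, paired. [AroraBarak2009, §0.1] -/
abbrev tripleE : ℕ × ℕ × ℕ → List Bool := pairE natE (pairE natE natE)

/-- Raw code of an untyped sparse map: three nested raw lists of numerals. [AroraBarak2009, §0.1] -/
abbrev polyE : List (List (List ℕ)) → List Bool := rawE (rawE (rawE natE))

/-- Code of untyped TI instances (the `CodeFP` form of `TIInst.encoding`). [AroraBarak2009, §0.1] -/
abbrev tiE : ℕ × ℕ × ℕ × List (ℕ × ℕ × ℕ) × List (ℕ × ℕ × ℕ) → List Bool :=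
  pairE natE (pairE natE (pairE natE (pairE (listE tripleE) (listE tripleE))))

/-- Code of untyped `PED` instances (`CodeFP` form of `PEDInst.encoding`). [AroraBarak2009, §0.1] -/
abbrev pedE : (ℕ × List (List (List ℕ))) × (ℕ × List (List (List ℕ))) → List Bool :=
  pairE (pairE natE (listE (listE (listE natE)))) (pairE natE (listE (listE (listE natE))))

/-- The code of a triple of naturals is injective. [folklore] -/
theorem tripleE_injective : Function.Injective tripleE :=
  pairE_injective natE_injective (pairE_injective natE_injective natE_injective)

/-- `nvars` on codes. [AroraBarak2009, §1.3] -/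
theorem codeFP_nvars : CodeFP tripleE natE (fun q => nvars q.1 q.2.1 q.2.2) := by
  have ha : CodeFP tripleE natE (fun q => q.1) := fst _ _
  have hb : CodeFP tripleE natE (fun q => q.2.1) := (snd _ _).fst'
  have hc : CodeFP tripleE natE (fun q => q.2.2) := (snd _ _).snd'
  exact (natAdd.comp ((natAdd.comp ((natMul.comp (ha.pair ha)).pair
    (natMul.comp (hb.pair hb)))).pair (natMul.comp (hc.pair hc)))).congr fun _ => rfl

/-- One monomial on codes (argument `((q, o), p)`). [AroraBarak2009, §1.3] -/
theorem codeFP_monoN : CodeFP (pairE (pairE tripleE tripleE) tripleE) (rawE natE)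
    (fun t => monoN t.1.1 t.1.2 t.2) := by
  have hq : CodeFP (pairE (pairE tripleE tripleE) tripleE) tripleE fun t => t.1.1 := (fst _ _).fst'
  have ho : CodeFP (pairE (pairE tripleE tripleE) tripleE) tripleE fun t => t.1.2 := (fst _ _).snd'
  have hp : CodeFP (pairE (pairE tripleE tripleE) tripleE) tripleE fun t => t.2 := snd _ _
  have ha := hq.fst'
  have hb := hq.snd'.fst'
  have x1 := natAdd.comp (hp.fst'.pair (natMul.comp (ha.pair ho.fst')))
  have x2 := natAdd.comp ((natMul.comp (ha.pair ha)).pair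
    (natAdd.comp (hp.snd'.fst'.pair (natMul.comp (hb.pair ho.snd'.fst')))))
  have x3 := natAdd.comp ((natAdd.comp ((natMul.comp (ha.pair ha)).pair
    (natMul.comp (hb.pair hb)))).pair
    (natAdd.comp (hp.snd'.snd'.pair (natMul.comp (hq.snd'.snd'.pair ho.snd'.snd')))))
  exact ((rawCons natE).comp (x1.pair ((rawCons natE).comp (x2.pair ((rawSingleton natE).comp
    x3))))).congr fun _ => rfl

/-- **The untyped orbit map on codes** (argument `((q, supp), oi)`). [AroraBarak2009, §1.3] -/
theorem codeFP_orbitN : CodeFP (pairE (pairE tripleE (rawE tripleE)) (rawE tripleE)) polyE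
    (fun t => orbitN t.1.1 t.2 t.1.2) := by
  have hrow : CodeFP (pairE (pairE tripleE (rawE tripleE)) tripleE) (rawE (rawE natE))
      (fun t => t.1.2.map (monoN t.1.1 t.2)) := ((CodeFP.map codeFP_monoN).comp
    (((fst _ _).fst'.pair (snd _ _)).pair (fst _ _).snd')).congr fun _ => rfl
  exact (CodeFP.map hrow).congr fun _ => rfl

/-- **The untyped mixture map on codes** (argument `((q, (sT, sX)), oi)`). [AroraBarak2009, §1.3] -/
theorem codeFP_mixN :
    CodeFP (pairE (pairE tripleE (pairE (rawE tripleE) (rawE tripleE))) (rawE tripleE)) polyE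
      (fun t => mixN t.1.1 t.2 t.1.2.1 t.1.2.2) := by
  let C := pairE (pairE tripleE (pairE (rawE tripleE) (rawE tripleE))) tripleE
  have hc : CodeFP (pairE natE (rawE natE)) (rawE natE) (fun t => t.1 :: t.2) := rawCons natE
  have hr : ∀ {f : _ → List (ℕ × ℕ × ℕ)}, CodeFP C (rawE tripleE) f →
      CodeFP C (rawE (rawE natE)) fun t => (f t).map (monoN t.1.1 t.2) := fun hf =>
    ((CodeFP.map codeFP_monoN).comp (((fst _ _).fst'.pair (snd _ _)).pair hf)).congr fun _ => rfl
  have hrow : CodeFP C (rawE (rawE natE)) (fun t => t.1.2.1.map (monoN t.1.1 t.2) ++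
        (t.1.2.2.map (monoN t.1.1 t.2)).map (List.cons (nvars t.1.1.1 t.1.1.2.1 t.1.1.2.2))) :=
    ((rawAppend _).comp ((hr (fst _ _).snd'.fst').pair ((CodeFP.map hc).comp
      ((codeFP_nvars.comp (fst _ _).fst').pair (hr (fst _ _).snd'.snd'))))).congr fun _ => rfl
  exact (CodeFP.map hrow).congr fun _ => rfl

/-- **Re-indexing on codes** (argument `(s, P)`). [AroraBarak2009, §1.3] -/
theorem codeFP_shiftN : CodeFP (pairE natE polyE) polyE (fun t => shiftN t.1 t.2) := by
  have h1 : CodeFP (pairE natE (rawE natE)) (rawE natE) (fun t => t.2.map fun i => t.1 + i) :=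
    (CodeFP.map natAdd).congr fun _ => rfl
  have h2 : CodeFP (pairE natE (rawE (rawE natE))) (rawE (rawE natE))
      (fun t => t.2.map (List.map fun i => t.1 + i)) := (CodeFP.map h1).congr fun _ => rfl
  exact (CodeFP.map h2).congr fun _ => rfl

/-- **Iterated direct products on codes** (argument `((n, P), ts)`). [AroraBarak2009, §1.3] -/
theorem codeFP_powN : CodeFP (pairE (pairE natE polyE) (rawE natE)) polyE
    (fun t => powN t.1.1 t.1.2 t.2) := by
  have hitem : CodeFP (pairE (pairE natE polyE) natE) polyE (fun t => shiftN (t.1.1 * t.2) t.1.2) :=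
    codeFP_shiftN.comp ((natMul.comp ((fst _ _).fst'.pair (snd _ _))).pair (fst _ _).snd')
  exact ((flatten (rawE (rawE natE))).comp (CodeFP.map hitem)).congr fun _ => rfl

/-- `suppXN` on codes (argument `((LS, LT), oi)`). [AroraBarak2009, §1.3] -/
theorem codeFP_suppXN : CodeFP (pairE (pairE (rawE tripleE) (rawE tripleE)) (rawE tripleE))
    (rawE tripleE) (fun t => suppXN t.1.1 t.1.2 t.2) := by
  have hS : CodeFP (pairE (pairE (rawE tripleE) (rawE tripleE)) tripleE) bitE
      fun t => decide (t.2 ∈ t.1.1) := (mem tripleE_injective).comp ((snd _ _).pair (fst _ _).fst')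
  have hT : CodeFP (pairE (pairE (rawE tripleE) (rawE tripleE)) tripleE) bitE
      fun t => decide (t.2 ∈ t.1.2) := (mem tripleE_injective).comp ((snd _ _).pair (fst _ _).snd')
  exact CodeFP.filter (((beq bitE_injective).comp (hS.pair hT)).not.congr fun _ => rfl)

/-- **`pedN` on codes** (argument `(q, oi, LS, LT)`, all lists raw). [AroraBarak2009, §1.3] -/
theorem codeFP_pedN :
    CodeFP (pairE tripleE (pairE (rawE tripleE) (pairE (rawE tripleE) (rawE tripleE))))
      (pairE (pairE natE polyE) (pairE natE polyE)) (fun t => pedN t.1 t.2.1 t.2.2.1 t.2.2.2) := by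
  let pedArgE := pairE tripleE (pairE (rawE tripleE) (pairE (rawE tripleE) (rawE tripleE)))
  have hq : CodeFP pedArgE tripleE (fun t => t.1) := fst _ _
  have hoi : CodeFP pedArgE (rawE tripleE) (fun t => t.2.1) := (snd _ _).fst'
  have hLS : CodeFP pedArgE (rawE tripleE) (fun t => t.2.2.1) := (snd _ _).snd'.fst'
  have hLT : CodeFP pedArgE (rawE tripleE) (fun t => t.2.2.2) := (snd _ _).snd'.snd'
  have hn : CodeFP pedArgE natE (fun t => nvars t.1.1 t.1.2.1 t.1.2.2) := codeFP_nvars.comp hq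
  have hs : ∀ {f : _ → List (ℕ × ℕ × ℕ)}, CodeFP pedArgE (rawE tripleE) f →
      CodeFP pedArgE (rawE tripleE) fun t => suppN (f t) t.2.1 := fun hf =>
    ((CodeFP.filter ((mem tripleE_injective).comp ((snd _ _).pair (fst _ _)))).comp
      (hf.pair hoi)).congr fun _ => rfl
  have hsX : CodeFP pedArgE (rawE tripleE) (fun t => suppXN t.2.2.1 t.2.2.2 t.2.1) :=
    codeFP_suppXN.comp ((hLS.pair hLT).pair hoi)
  have hpow : ∀ {f : _ → List (ℕ × ℕ × ℕ)}, CodeFP pedArgE (rawE tripleE) f → CodeFP pedArgE polyE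
      fun t => powN (nvars t.1.1 t.1.2.1 t.1.2.2) (orbitN t.1 t.2.1 (suppN (f t) t.2.1))
        (List.range 64) :=
    fun hf => codeFP_powN.comp ((hn.pair (codeFP_orbitN.comp ((hq.pair (hs hf)).pair hoi))).pair
      (const _ (List.range 64)))
  have hP : CodeFP pedArgE polyE (fun t => powN (nvars t.1.1 t.1.2.1 t.1.2.2 + 1)
      (mixN t.1 t.2.1 (suppN t.2.2.2 t.2.1) (suppXN t.2.2.1 t.2.2.2 t.2.1)) (List.range 128)) :=
    codeFP_powN.comp (((natAdd.comp (hn.pair (const _ 1))).pair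
      (codeFP_mixN.comp ((hq.pair ((hs hLT).pair hsX)).pair hoi))).pair (const _ (List.range 128)))
  have hn64 : CodeFP pedArgE natE (fun t => nvars t.1.1 t.1.2.1 t.1.2.2 * 64) :=
    natMul.comp (hn.pair (const _ 64))
  have hQ : CodeFP pedArgE polyE (fun t =>
      powN (nvars t.1.1 t.1.2.1 t.1.2.2) (orbitN t.1 t.2.1 (suppN t.2.2.1 t.2.1)) (List.range 64) ++
        shiftN (nvars t.1.1 t.1.2.1 t.1.2.2 * 64) (powN (nvars t.1.1 t.1.2.1 t.1.2.2)
            (orbitN t.1 t.2.1 (suppN t.2.2.2 t.2.1)) (List.range 64) ++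
          shiftN (nvars t.1.1 t.1.2.1 t.1.2.2 * 64) [[[0]]])) :=
    (rawAppend _).comp ((hpow hLS).pair (codeFP_shiftN.comp (hn64.pair ((rawAppend _).comp
      ((hpow hLT).pair (codeFP_shiftN.comp (hn64.pair (const _ [[[0]]]))))))))
  have hnP : CodeFP pedArgE natE (fun t => (nvars t.1.1 t.1.2.1 t.1.2.2 + 1) * 128) :=
    natMul.comp ((natAdd.comp (hn.pair (const _ 1))).pair (const _ 128))
  have hnQ : CodeFP pedArgE natE
      (fun t => nvars t.1.1 t.1.2.1 t.1.2.2 * 64 + (nvars t.1.1 t.1.2.1 t.1.2.2 * 64 + 1)) :=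
    natAdd.comp (hn64.pair (natAdd.comp (hn64.pair (const _ 1))))
  exact ((hnP.pair hP).pair (hnQ.pair hQ)).congr fun _ => rfl

/-- **The untyped guarded instance map `progN` is computed on codes by a polynomial-time string
function.** [AroraBarak2009, §1.3] -/
theorem codeFP_progN : CodeFP tiE pedE progN := by
  have ha : CodeFP tiE natE (fun x => x.1) := fst _ _
  have hb : CodeFP tiE natE (fun x => x.2.1) := (snd _ _).fst'
  have hc : CodeFP tiE natE (fun x => x.2.2.1) := (snd _ _).snd'.fst'
  have hL : ∀ {f : _ → List (ℕ × ℕ × ℕ)}, CodeFP tiE (listE tripleE) f →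
      CodeFP tiE (rawE tripleE) f := fun hf => (rawOfList _).comp hf
  have hLS : CodeFP tiE (rawE tripleE) fun x => x.2.2.2.1 := hL (snd _ _).snd'.snd'.fst'
  have hLT : CodeFP tiE (rawE tripleE) fun x => x.2.2.2.2 := hL (snd _ _).snd'.snd'.snd'
  have hlen : CodeFP tiE natE (fun x => x.2.2.2.1.length) := (natLength _).comp hLS
  have hguard : CodeFP tiE bitE (fun x => decide (x.1 ≤ x.2.2.2.1.length) &&
      (decide (x.2.1 ≤ x.2.2.2.1.length) && decide (x.2.2.1 ≤ x.2.2.2.1.length))) :=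
    (natLe.comp (ha.pair hlen)).and ((natLe.comp (hb.pair hlen)).and (natLe.comp (hc.pair hlen)))
  have hr : ∀ {f : _ → ℕ}, CodeFP tiE natE f →
      CodeFP tiE (rawE natE) fun x => List.range (min (f x) x.2.2.2.1.length) :=
    fun hf => (brange _).comp (hLS.pair hf)
  have hoi : CodeFP tiE (rawE tripleE) (fun x => List.range (min x.1 x.2.2.2.1.length) ×ˢ
      (List.range (min x.2.1 x.2.2.2.1.length) ×ˢ List.range (min x.2.2.1 x.2.2.2.1.length))) :=
    ((rawProduct natE (pairE natE natE)).comp ((hr ha).pair ((rawProduct natE natE).comp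
      ((hr hb).pair (hr hc))))).congr fun _ => rfl
  have hthen := codeFP_pedN.comp ((ha.pair (hb.pair hc)).pair (hoi.pair (hLS.pair hLT)))
  have hhead : CodeFP polyE (listE (listE (listE natE))) id :=
    ((listOfRaw (listE (listE natE))).comp (map₀ ((listOfRaw (listE natE)).comp
      (map₀ (listOfRaw natE))))).congr fun P => by simp
  have hout : CodeFP (pairE (pairE natE polyE) (pairE natE polyE)) pedE id :=
    (((fst _ _).fst'.pair (hhead.comp (fst _ _).snd')).pair
      ((snd _ _).fst'.pair (hhead.comp (snd _ _).snd'))).congr fun _ => rfl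
  exact (hout.comp (hguard.ite hthen (const _ ((0, []), (1, [[[0]]]))))).congr fun x => by
    simp only [progN, id]

variable {a b c : ℕ}

/-- An index triple `(i, (j, k))` as a triple of naturals. [folklore] -/
def valT (p : Fin a × Fin b × Fin c) : ℕ × ℕ × ℕ := (p.1.val, p.2.1.val, p.2.2.val)

/-- The untyped presentation of a TI instance. [folklore] -/
def rawTI (I : TIInst) : ℕ × ℕ × ℕ × List (ℕ × ℕ × ℕ) × List (ℕ × ℕ × ℕ) :=
  (I.1, I.2.1, I.2.2.1, I.2.2.2.1.map valT, I.2.2.2.2.map valT)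

/-- The untyped presentation of a `PED` instance (variable indices as naturals). [folklore] -/
def rawPED (J : PEDInst) : (ℕ × List (List (List ℕ))) × (ℕ × List (List (List ℕ))) :=
  ((J.1.1, RandPoly.natOf J.1.2), (J.2.1, RandPoly.natOf J.2.2))

/-- `valT` is injective. [folklore] -/
theorem valT_injective : Function.Injective (valT : Fin a × Fin b × Fin c → ℕ × ℕ × ℕ) := by
  rintro ⟨i, j, k⟩ ⟨i', j', k'⟩ h
  simp only [valT, Prod.mk.injEq, Fin.val_inj] at h
  rw [h.1, h.2.1, h.2.2]

/-- **The code of a TI instance is the `CodeFP` code of its untyped presentation.**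
[AroraBarak2009, §0.1] -/
theorem encode_eq_tiE (I : TIInst) : TIInst.encoding.encode I = tiE (rawTI I) := by
  obtain ⟨a, b, c, LS, LT⟩ := I
  have h : ((tripleEncoding a b c).encode : Fin a × Fin b × Fin c → List Bool) =
      fun p => tripleE (valT p) := rfl
  change boolPair (encodeNat a) (boolPair (encodeNat b) (boolPair (encodeNat c)
    (boolPair ((tripleEncoding a b c).listBool.encode LS)
      ((tripleEncoding a b c).listBool.encode LT)))) = _
  rw [listE_eq, h, RandPoly.listE_comp tripleE valT]
  rfl

/-- **The code of a `PED` instance is the `CodeFP` code of its untyped presentation.**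
[AroraBarak2009, §0.1] -/
theorem encode_eq_pedE (J : PEDInst) : PEDInst.encoding.encode J = pedE (rawPED J) := by
  obtain ⟨⟨n, P⟩, ⟨n', Q⟩⟩ := J
  have h3 : ∀ m, ((PolyMapF2.encoding m).encode : PolyMapF2 m → List Bool) =
      listE (listE (listE natE)) ∘ RandPoly.natOf := fun m => by
    rw [PolyMapF2.encoding, listE_eq, listE_eq, listE_eq,
      show ((encodingFinBool m).encode : Fin m → List Bool) = fun i => natE i.val from rfl,
      RandPoly.listE_comp natE Fin.val, RandPoly.listE_comp (listE natE) (List.map Fin.val),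
      RandPoly.listE_comp (listE (listE natE)) (List.map (List.map Fin.val))]
    rfl
  change boolPair (boolPair (encodeNat n) ((PolyMapF2.encoding n).encode P))
    (boolPair (encodeNat n') ((PolyMapF2.encoding n').encode Q)) = _
  rw [h3, h3]
  rfl

/-- Output positions: `outIdx` as naturals is the product of ranges. [folklore] -/
theorem map_valT_outIdx (a b c : ℕ) :
    (outIdx a b c).map valT = List.range a ×ˢ (List.range b ×ˢ List.range c) := by
  simp only [outIdx, ← List.map_coe_finRange_eq_range, SProd.sprod, List.product, List.map_flatMap,
    List.flatMap_map, List.map_map, Function.comp_def, valT]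

/-- One monomial: the values of `varA`, `varB`, `varC`. [folklore] -/
theorem map_val_mono (o p : Fin a × Fin b × Fin c) :
    (mono o p).map Fin.val = monoN (a, b, c) (valT o) (valT p) := rfl

/-- The orbit map as naturals. [card tensor-orbit-two-query] -/
theorem natOf_orbitMap (T : Tensor3 a b c) : RandPoly.natOf (orbitMap T) =
    orbitN (a, b, c) ((outIdx a b c).map valT) ((suppList T).map valT) := by
  simp only [RandPoly.natOf, orbitMap, orbitN, List.map_map, Function.comp_def, map_val_mono]

/-- The mixture map as naturals. [card tensor-iso-monoid-import] -/
theorem natOf_mixMap (S T : Tensor3 a b c) : RandPoly.natOf (mixMap S T) = mixN (a, b, c)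
    ((outIdx a b c).map valT) ((suppList T).map valT) ((suppList (S + T)).map valT) := by
  have h1 : ∀ o p : Fin a × Fin b × Fin c, ((mono o p).map Fin.castSucc).map Fin.val =
      monoN (a, b, c) (valT o) (valT p) := fun o p => by rw [List.map_map, ← map_val_mono]; rfl
  simp only [RandPoly.natOf, mixMap, mixN, List.map_map, Function.comp_def, List.map_append,
    List.map_cons, Fin.val_last, h1]

/-- The support tensor of `L` as naturals: the membership filter of the positions. [folklore] -/
theorem map_valT_suppList (L : List (Fin a × Fin b × Fin c)) :
    (suppList (ofSupport L)).map valT = suppN (L.map valT) ((outIdx a b c).map valT) := by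
  rw [suppList, suppN, List.filter_map]
  refine congrArg _ (List.filter_congr fun p _ => ?_)
  have h01 : ¬ ((0 : ZMod 2) = 1) := by decide
  simp only [Function.comp_apply, ofSupport, Matrix.of_apply, Prod.mk.eta,
    List.mem_map_of_injective valT_injective]
  by_cases hp : p ∈ L <;> simp [hp, h01]

/-- The sum of two support tensors as naturals: the exactly-one filter (`1 + 1 = 0` in `F₂`).
[folklore] -/
theorem map_valT_suppList_add (LS LT : List (Fin a × Fin b × Fin c)) :
    (suppList (ofSupport LS + ofSupport LT)).map valT =
      suppXN (LS.map valT) (LT.map valT) ((outIdx a b c).map valT) := by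
  rw [suppList, suppXN, List.filter_map]
  refine congrArg _ (List.filter_congr fun p _ => ?_)
  have h01 : ¬ ((0 : ZMod 2) = 1) := by decide
  have h11 : ¬ ((1 : ZMod 2) + 1 = 1) := by decide
  simp only [Function.comp_apply, Matrix.add_apply, ofSupport, Matrix.of_apply, Prod.mk.eta,
    List.mem_map_of_injective valT_injective]
  by_cases hS : p ∈ LS <;> by_cases hT : p ∈ LT <;> simp [hS, hT, h01, h11]

/-- Direct products as naturals: concatenate, re-indexing the second factor.
[DvirGutfreundRothblumVadhan2010, §3 p.6] -/
theorem natOf_prod {n n' : ℕ} (P : PolyMapF2 n) (Q : PolyMapF2 n') :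
    RandPoly.natOf (P.prod Q) = RandPoly.natOf P ++ shiftN n (RandPoly.natOf Q) := by
  simp [RandPoly.natOf, PolyMapF2.prod, shiftN, List.map_map, Function.comp_def]

/-- Iterated direct products as naturals. [DvirGutfreundRothblumVadhan2010, §3 p.6] -/
theorem natOf_powMap {n : ℕ} (P : PolyMapF2 n) (t : ℕ) :
    RandPoly.natOf (powMap P t) = powN n (RandPoly.natOf P) (List.range t) := by
  induction t with
  | zero => rfl
  | succ t ih =>
    show RandPoly.natOf ((powMap P t).prod P) = _
    rw [natOf_prod, ih, List.range_succ]
    simp [powN]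

/-- The identity map on one variable as naturals. [folklore] -/
theorem natOf_idMap_one : RandPoly.natOf (PolyMapF2.idMap 1) = [[[0]]] := by
  simp [RandPoly.natOf, PolyMapF2.idMap, List.finRange_succ]

/-- **The untyped presentation of the guarded instance map is the untyped program**:
`rawPED (pedOfG I) = progN (rawTI I)`. [card tensor-iso-monoid-import] -/
theorem rawPED_pedOfG (I : TIInst) : rawPED (pedOfG I) = progN (rawTI I) := by
  obtain ⟨a, b, c, LS, LT⟩ := I
  by_cases h : a ≤ LS.length ∧ b ≤ LS.length ∧ c ≤ LS.length
  · obtain ⟨ha, hb, hc⟩ := h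
    have hg : guardOK ⟨a, b, c, LS, LT⟩ = true := by simp [guardOK, ha, hb, hc]
    have hp : progN (rawTI ⟨a, b, c, LS, LT⟩) =
        pedN (a, b, c) ((outIdx a b c).map valT) (LS.map valT) (LT.map valT) := by
      simp [progN, rawTI, ha, hb, hc, map_valT_outIdx]
    rw [pedOfG, if_pos hg, hp]
    simp only [rawPED, pedOf, pedP, pedQ, TIInst.fstT, TIInst.sndT, natOf_powMap, natOf_prod,
      natOf_mixMap, natOf_orbitMap, map_valT_suppList, map_valT_suppList_add, natOf_idMap_one,
      pedN]
  · have hg : ¬ guardOK ⟨a, b, c, LS, LT⟩ = true := by simpa [guardOK] using h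
    have hp : progN (rawTI ⟨a, b, c, LS, LT⟩) = ((0, []), (1, [[[0]]])) := by
      rw [progN, if_neg]
      simpa [rawTI] using h
    rw [pedOfG, if_neg hg, hp]
    show ((0, RandPoly.natOf ([] : PolyMapF2 0)), (1, RandPoly.natOf (PolyMapF2.idMap 1))) = _
    rw [natOf_idMap_one]
    rfl

/-- **stub_instanceFP** (C1): the GUARDED instance map `pedOfG` (= `pedOf` when every format is at
most the length of the first support list, a fixed NO instance otherwise — so that the output length
is polynomial although formats are binary) is computed on codes by a polynomial-time string function
(`CodeFP`: lists, numerals, bounded loops). [card tensor-orbit-two-query; AroraBarak2009, §1.3] -/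
theorem stub_instanceFP : CodeFP TIInst.encoding.encode PEDInst.encoding.encode pedOfG := by
  obtain ⟨f, hf, hspec⟩ := codeFP_progN
  refine ⟨f, hf, fun I => ?_⟩
  rw [encode_eq_tiE, hspec, ← rawPED_pedOfG, encode_eq_pedE]

end Summit.PneNP.PneNP.Cruxes.PeaThreeNotInP.TensorIsoLine
end
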